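import Summits.ValiantsHypothesis.ValiantsHypothesis.Theorems.LacunarySymmetroidMatrixDescartesWLawTwoChambers

/-!
# `MatrixDescartes` (stmt-ValiantsHypothesis-18050) — pivot column at `m = 2`: R1₂ SHARPENED BY ADJACENT PIVOT DEGREES
# (`Z₊ ≤ 2K` when two pivot degrees are not separated by a pair sum; `Z₊ ≤ 2K` whenever a PSD letter sits at distance `1` from the pivot)

HONEST FRAMING.  Cell `pub-symmetroid`, seat `val-sym-mdr-p1` (gen 4); helper `--supports` the crux
`Theses.LacunarySymmetroid.MatrixDescartes` (OPEN), NO closure claim.  conjb-1 g0's R1₂ (`Pivot.TwoDescartes.pivotTwo_posRoots_le`):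
a `2 × 2` pivot pencil `X^e J + ∑ₖ X^{dₖ} Pₖ` (`J` ANY symmetric, `Pₖ ⪰ 0`, `K` letters) has `Z₊ ≤ 2K + 2`, because a negative coefficient
of the determinant sits at one of the `K + 1` pivot degrees `2e`, `e + dₖ`.  With the clustered budgets of `…WLawTwoSignBudgets` this file
records the general-`K` form of the `n = 2` chamber law of `…WLawTwoChambers`:

* `pivotTwo_posRoots_le_of_pair` — if two pivot degrees `u < v` have NO pair sum `expo l + expo l'` strictly between them, `Z₊ ≤ 2K`;
* `pivotTwo_posRoots_le_of_near_letter` — in particular **`Z₊ ≤ 2K` as soon as some PSD letter sits at distance one from the pivot**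
  (`dₖ + 1 = e` or `e + 1 = dₖ`: the pivot degrees `e + dₖ` and `2e` are consecutive integers);
* `pivotRootLawAt_two_of_near_letter` — the same in the column's currency `pivotPosRoots` (hypotheses of `PivotRootLawAt` unused).

Located context (not used): conjb-1's floor of record `2K − 3` (K = 4,5,6) and the W-witness `6 = 2K` (K = 3).  Nothing here bears on the
column for `m ≥ 3`, on `MatrixDescartes` in its window, `DoorA26`/`DoorA34`, or `VP ≠ VNP`.

[folklore] Descartes' rule of signs with sign bookkeeping; no source.
-/

-- `Summit.ValiantsHypothesis.ValiantsHypothesis.…` repeats a component by the D-0017 layout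
-- (single-conjunct summit), which the `dupNamespace` linter flags; the name is mandated.
set_option linter.dupNamespace false

namespace Summit.ValiantsHypothesis.ValiantsHypothesis.Theorems.LacunarySymmetroidMatrixDescartes

open Polynomial Finset
open scoped BigOperators

namespace WLawTwoChambers

open Pivot.TwoDescartes (letter expo pencil_eq_sum)

variable {K : ℕ}

/-- **R1₂ sharpened by an adjacent pair**: for a `2 × 2` pivot pencil with `K` PSD letters, if two pivot degrees `u < v`
(members of `{e + expo l}`) have no pair sum `expo l + expo l'` strictly between them, then `Z₊ ≤ 2K`. -/
theorem pivotTwo_posRoots_le_of_pair (e : ℕ) (d : Fin K → ℕ) (J : Matrix (Fin 2) (Fin 2) ℝ)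
    (P : Fin K → Matrix (Fin 2) (Fin 2) ℝ) (hP : ∀ k, (P k).PosSemidef) (u v : ℕ) (huv : u < v)
    (hu : ∃ l, e + expo e d l = u) (hv : ∃ l, e + expo e d l = v)
    (hgap : ∀ l l', ¬ (u < expo e d l + expo e d l' ∧ expo e d l + expo e d l' < v)) :
    ((Matrix.det (((X : ℝ[X]) ^ e) • J.map Polynomial.C
        + ∑ k, ((X : ℝ[X]) ^ d k) • (P k).map Polynomial.C)).roots.toFinset.filter (fun t => 0 < t)).card
      ≤ 2 * K := by
  classical
  rw [pencil_eq_sum]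
  set F := Matrix.det (∑ l, ((X : ℝ[X]) ^ expo e d l) • (letter J P l).map Polynomial.C) with hF
  let T : Finset ℕ := (Finset.univ : Finset (Option (Fin K))).image (fun l => e + expo e d l)
  have hTcard : T.card ≤ K + 1 := by
    refine le_trans Finset.card_image_le ?_
    simp [Fintype.card_option]
  have hT : ∀ n, F.coeff n < 0 → n ∈ T := fun n hn => neg_mem_image e d J P hP n hn
  have huT : u ∈ T := by
    obtain ⟨l, hl⟩ := hu
    exact Finset.mem_image.mpr ⟨l, Finset.mem_univ _, hl⟩
  have hvT : v ∈ T := by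
    obtain ⟨l, hl⟩ := hv
    exact Finset.mem_image.mpr ⟨l, Finset.mem_univ _, hl⟩
  have hgap' : ∀ m, u < m → m < v → F.coeff m = 0 := fun m hm1 hm2 =>
    coeff_det_eq_zero_of_forall_ne e d J P m fun l l' hm => hgap l l' ⟨by omega, by omega⟩
  have h1 := signVariations_pair_budget F T hT u v huv huT hvT hgap'
  have h2 := card_posRoots_le_signVariations F
  omega

/-- **A letter at distance one from the pivot costs the budget its slack**: if `dₖ + 1 = e` or `e + 1 = dₖ` for some `k`,
then `Z₊ ≤ 2K` (the pivot degrees `e + dₖ` and `2e` are consecutive integers, so nothing lies strictly between them). -/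
theorem pivotTwo_posRoots_le_of_near_letter (e : ℕ) (d : Fin K → ℕ) (J : Matrix (Fin 2) (Fin 2) ℝ)
    (P : Fin K → Matrix (Fin 2) (Fin 2) ℝ) (hP : ∀ k, (P k).PosSemidef) (k : Fin K)
    (hk : d k + 1 = e ∨ e + 1 = d k) :
    ((Matrix.det (((X : ℝ[X]) ^ e) • J.map Polynomial.C
        + ∑ k, ((X : ℝ[X]) ^ d k) • (P k).map Polynomial.C)).roots.toFinset.filter (fun t => 0 < t)).card
      ≤ 2 * K := by
  rcases hk with hk | hk
  · -- `e + dₖ < 2e` consecutive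
    refine pivotTwo_posRoots_le_of_pair e d J P hP (e + d k) (e + e) (by omega) ⟨some k, rfl⟩ ⟨none, rfl⟩
      fun l l' h => ?_
    omega
  · -- `2e < e + dₖ` consecutive
    refine pivotTwo_posRoots_le_of_pair e d J P hP (e + e) (e + d k) (by omega) ⟨none, rfl⟩ ⟨some k, rfl⟩
      fun l l' h => ?_
    omega

end WLawTwoChambers

namespace Pivot

/-- **Column currency**: a `2 × 2` pivot pencil with `K` PSD letters one of which sits at distance one from the pivot has
`pivotPosRoots ≤ 2K` (for every index; the index hypothesis of `PivotRootLawAt` is not needed at `m = 2`). -/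
theorem pivotRootLawAt_two_of_near_letter {K : ℕ} (e : ℕ) (d : Fin K → ℕ) (J : Matrix (Fin 2) (Fin 2) ℝ)
    (P : Fin K → Matrix (Fin 2) (Fin 2) ℝ) (hP : ∀ k, (P k).PosSemidef) (k : Fin K) (hk : d k + 1 = e ∨ e + 1 = d k) :
    pivotPosRoots e d J P ≤ 2 * K :=
  WLawTwoChambers.pivotTwo_posRoots_le_of_near_letter e d J P hP k hk

end Pivot

end Summit.ValiantsHypothesis.ValiantsHypothesis.Theorems.LacunarySymmetroidMatrixDescartes
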